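import Summits.ABC.ABC.Theses.IneffectiveSubspace
import Summits.ABC.ABC.Theorems.IneffectiveSubspaceAbcGivesUniformSadic
import Summits.ABC.ABC.Theorems.IneffectiveSubspaceUniformSadicGivesTowerFour
import Summits.ABC.ABC.Theorems.TowerFourSubLiouville.Negative.DialCalibration
import Summits.ABC.ABC.Theorems.TowerFourSubLiouville.Negative.LogLoss

/-!
# Disproof of `UniformSadicTowerFour` (stmt-ABC-14937) — findings of the standing disprover

Crux (route `IneffectiveSubspace`, rank 2): for every `K`, `ε > 0` there is `C(K, ε)` such that for
every set `S` of at most `K` primes and every positive coprime level-4 tower point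
`x₁x₂²x₃³x₄⁴ + y₁y₂²y₃³y₄⁴ = z₁z₂²z₃³z₄⁴` one has `c := ∏ zᵢ^(i+1) < C·((∏_{p∈S} p)·{M}^S)^(1+ε)`,
`M = ∏ xᵢyᵢzᵢ`, `{M}^S = ∏_{p ∣ M, p ∉ S} p^{v_p(M)}` (the `S`-free part; "the bracket" below).

## Findings (cycle 1, refuter-cdisprove-stmt-ABC-14937-0, 2026-08-16)

* **Why it resists (no kill short of `¬ABC`).** `ABC ⟹ crux` is landed
  (`Theorems.abcGivesUniformSadic_proof`), so every refutation of the crux is an abc counterexample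
  family: `not_abc_of_not_uniformSadicTowerFour`.  Downwards, `crux(K = 0, S = ∅)` is Vojta's level-4
  inequality with exponent `1` (`towerIneq4One_of_uniformSadicTowerFour`), itself abc-strength
  (abc with exponent ≈ 4 on cube-free triples).  The normal form of a counterexample is an infinite
  family of abc triples with `limsup log c / log M_S(abc) > 1`, `M_S` the mixed radical — i.e. abc
  quality `> 1 + δ` after discounting the `K` largest level-4 overcharges; census (crux dir,
  BarrierNotes-r1-k2 / StructureNotes-r1-k1): max `tq_0 = 1.3007` (`1 + 4374 = 4375`), nothing grows.
* **(a) Load-bearing hypotheses** (each dropped in turn; all inlined, no auxiliary `def`):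
  - coprimality IS load-bearing — `uniformSadicTowerFour_false_without_coprime`
    (`2^n + 2^n = 2^{n+1}`, `S = {2}` swallows everything: bracket `= 2`); contrast the sibling crux
    `TowerFourSubLiouville`, where dropping coprimality only moves the floor to `4/3`;
  - primality of `S` is load-bearing ONLY through `0 ∈ S` — `uniformSadicTowerFour_false_without_prime`
    (`S = {0}` makes the bracket `0`); composites / `1` in `S` only enlarge the bracket (remark);
  - the equation is load-bearing — `uniformSadicTowerFour_false_without_eq` (`z = (1,1,1,m)`, `S = ∅`);
  - positivity is NOT load-bearing — `uniformSadicTowerFour_iff_without_pos`: a vanishing coordinate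
    forces `c ≤ 1` by coprimality while the bracket of `M = 0` is `∏_{p∈S} p ≥ 1`, so `C ↦ max C 2`
    absorbs the degenerate points (again unlike `TowerFourSubLiouville`, where `Π = 0` kills);
  - the budget `S.card ≤ K` (i.e. `C` free of `K`) is load-bearing EXACTLY to the extent `ABC` is open:
    the `K`-uniform statement is `ABC` on the nose (landed stub
    `Theorems/IneffectiveSubspaceUniformSadicTowerFourStubUniformInKIffAbc.lean`).
* **(b) Tightness.** `ε` cannot be dropped, already at `K = 0`: `uniformSadicTowerFour_false_without_eps`
  (Pell–Matiyasevich family of the sibling disprover, `Negative.DialCalibration.not_towerIneq4OneNoEps`,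
  transported through the `S = ∅` bracket); even a loss `(log c)^A`, `A < 1`, fails at `K = 0`
  (`uniformSadicTowerFour_false_logLoss`, from `Negative.LogLoss.not_towerIneq4One_logLoss`).
* **(c) The `S`-loss exponent** (docstring: "linear `S`-loss, forced … BHP").  Correction for the record:
  the family `(p², q²−p², q²)`, `q ≤ p + p^{0.525}` (Baker–Harman–Pintz) only forces the exponent `θ` of
  `(∏_{p∈S} p)^θ` above `≈ 0.2375`; bounded prime gaps (Zhang–Maynard, `(p, q−p, q)`, `S = {p,q}`) force
  `θ ≥ 1/2`; `θ ∈ [1/2, 1)` is forced only heuristically (primes `2^a3^b + 1`, `S = {2,3,p}`).  None of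
  these prime-distribution inputs is in Mathlib; the Lean-checked statements here are the conditionals
  `uniformSadicTowerFour_noSFactor_false_of_boundedGaps` (the `S`-factor cannot be dropped at `K = 2`)
  and `uniformSadicTowerFour_subsqrtSLoss_false_of_boundedGaps` (`(∏_{p∈S} p)^θ` with `0 ≤ θ < 1/2` is
  false at `K = 2`), both modulo bounded gaps between primes (hypothesis inlined; witness
  `p + (q−p) = q`, `S = {p, q}`, `S`-free part `∣ q − p` by `sfree_dvd`); and the LINEAR loss itself is
  forced — every `θ < 1` fails at `K = |S₀| + 1` — modulo infinitely many primes `p` with `p − 1` an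
  `S₀`-unit for some fixed finite `S₀` (`S₀ = {2,3}`: Pierpont primes; open but standard):
  `uniformSadicTowerFour_sublinearSLoss_false_of_smoothShiftedPrimes` (witness `1 + (p−1) = p`,
  `S = insert p S₀`, `S`-free part `1`).  So "linear `S`-loss forced" is exactly as safe as Gleason's
  conjecture, and no prime-distribution THEOREM pushes the floor above `1/2`.
* **(d) Constants.** With `C = 1` the exponent must exceed `39/25` at `K = 1` (`1 + 4374 = 4375`,
  `S = {3}`: bracket `210 = rad`, `not_uniformSadicTowerFour_one_constant_one_exponent_39_25`) and `81/50`
  at `K = 2` (Reyssat `2 + 3¹⁰·109 = 23⁵`, `S = {3, 23}`: bracket `15042 = rad`,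
  `not_uniformSadicTowerFour_two_constant_one_exponent_81_50`): two discounted places already put the whole
  empirical abc frontier (quality `1.63`) inside the crux's `K = 2` cell, versus `13/10` at `K = 0`
  (`Negative.DialCalibration.not_towerIneq4_constant_one_exponent_13_10`).
* **Line `Sketch` (lead prover-line-stmt-ABC-14937-0) — DEAD at `stub_core ≡ crux` (lead's
  `Lines/Sketch-dead.md`, end of its cycle 1).** The composition `stub_core + stub_tower_of_mixed_at` is
  gap-free (kernel-checked); `stub_core` is the crux in mixed-radical normal form (`stub_normalForm`,
  p99470: `UniformSadicTowerFour ↔ ∀ K, Mixed K`), hence exactly as unkillable as the crux; all ten other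
  stubs are LANDED theorems (table in `Sketch-dead.md`: transports p96324/p96155, normal form + `K = 0` face
  + level-one rung p99470, `K`-uniform ⟺ `ABC` p96181, places→level p96601, `ω(abc) ≤ 2` cell p97349, prime
  Hall from the level-one rung at `K = 2` p96636, level-one rung at `K = 1` p100802).  No stub was ever a
  target to break; payload `stuck_stubs = []`.
* **Landed under `Theorems/UniformSadicTowerFour/Negative/`** (all ACCEPTED, importable): `LoadBearing.lean`
  (p99091: (a)), `NoEps.lean` (p104304: (b)), `SLossFloor.lean` (p102774: (c), bounded-gaps half, with
  `sfree_dvd`), `SLossLinear.lean` (p111487: (c), smooth-shifted-primes half), `Constants.lean` (p111454: (d)).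
* **What would change the verdict.** Only an abc counterexample family (the crux is implied by `ABC`);
  short of that, the informative open calibrations are: the log-loss at `A = 1` (Pell/Lucas families gain
  at most `≍ log c`), an UNCONDITIONAL `S`-loss floor (needs primes in thin sets beyond Mathlib), and
  whether `C(K, ε)` must grow in `K` at all (it need not if `ABC` holds: `K`-uniform ⟺ `ABC`).
-/

-- `Summit.<Summit>.<Problem>` is the mandated summit-side namespace (CONVENTIONS §2); for the
-- single-conjunct summit `ABC` the two coincide, so the duplicate `ABC.ABC` is deliberate.
set_option linter.dupNamespace false

namespace Summit.ABC.ABC.Cruxes.UniformSadicTowerFour.Disproof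

open scoped BigOperators
open Summit.ABC.ABC.Theses.IneffectiveSubspace
open Summit.ABC.ABC.Theorems
open Summit.ABC.ABC.Theorems.TowerFourSubLiouville.Negative

/-! ## Framing: the sandwich `ABC ⟹ crux ⟹ TowerIneq(4, 1)` -/

/-- **Why it resists.** A refutation of the crux refutes `ABC` (contrapositive of the landed
`abcGivesUniformSadic_proof`). -/
theorem not_abc_of_not_uniformSadicTowerFour (h : ¬ UniformSadicTowerFour) : ¬ ABC :=
  fun habc => h (abcGivesUniformSadic_proof habc)

/-- **The `K = 0` face is Vojta's level-4 inequality with exponent `1`** (`S = ∅`: the bracket of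
`M ≠ 0` is `M`, `UniformSadicGivesTowerFour.bracket_empty`). -/
theorem towerIneq4One_of_uniformSadicTowerFour (h : UniformSadicTowerFour) :
    ∀ ε : ℝ, 0 < ε → ∃ C : ℝ, 0 < C ∧ ∀ x y z : Fin 4 → ℕ, (∀ i, 0 < x i ∧ 0 < y i ∧ 0 < z i) →
      (∏ i, x i ^ (i.val + 1)) + (∏ i, y i ^ (i.val + 1)) = ∏ i, z i ^ (i.val + 1) →
      Nat.Coprime (∏ i, x i ^ (i.val + 1)) (∏ i, y i ^ (i.val + 1)) →
      ((∏ i, z i ^ (i.val + 1) : ℕ) : ℝ) < C * ((∏ i, x i * y i * z i : ℕ) : ℝ) ^ (1 + ε) := by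
  intro ε hε
  obtain ⟨C, hC, hK⟩ := h 0 ε hε
  refine ⟨C, hC, fun x y z hpos hsum hcop => ?_⟩
  have hM : (∏ i, x i * y i * z i) ≠ 0 :=
    (Finset.prod_pos fun i _ =>
      Nat.mul_pos (Nat.mul_pos (hpos i).1 (hpos i).2.1) (hpos i).2.2).ne'
  have key := hK ∅ (by simp) (by simp) x y z hpos hsum hcop
  rwa [UniformSadicGivesTowerFour.bracket_empty hM] at key

/-! ## (a) Load-bearing hypotheses -/

/-- The bracket of a power of `2` at `S = {2}` is `2`: `{2^k}^{{2}} = 1`. -/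
theorem bracket_two_pow (k : ℕ) :
    (∏ p ∈ ({2} : Finset ℕ), p) * ∏ p ∈ (2 ^ k).primeFactors \ {2}, p ^ (2 ^ k).factorization p = 2 := by
  have hsub : (2 ^ k).primeFactors \ ({2} : Finset ℕ) = ∅ := by
    rcases Nat.eq_zero_or_pos k with rfl | hk
    · simp
    · rw [Nat.primeFactors_prime_pow hk.ne' Nat.prime_two, Finset.sdiff_self]
  rw [hsub, Finset.prod_empty, Finset.prod_singleton, mul_one]

/-- **Coprimality is load-bearing.** Without `Nat.Coprime a b` the crux fails (already at `K = 1`,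
`ε = 1`): the points `x = y = (2^n,1,1,1)`, `z = (2^{n+1},1,1,1)` (`2^n + 2^n = 2^{n+1}`) with
`S = {2}` have bracket `2·{2^{3n+1}}^{{2}} = 2`, so `2^{n+1} < C·2²` fails for `2^n > 4C`. -/
theorem uniformSadicTowerFour_false_without_coprime :
    ¬ ∀ K : ℕ, ∀ ε : ℝ, 0 < ε → ∃ C : ℝ, 0 < C ∧ ∀ S : Finset ℕ, S.card ≤ K → (∀ p ∈ S, Nat.Prime p) →
      ∀ x y z : Fin 4 → ℕ, (∀ i, 0 < x i ∧ 0 < y i ∧ 0 < z i) →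
      (∏ i, x i ^ (i.val + 1)) + (∏ i, y i ^ (i.val + 1)) = ∏ i, z i ^ (i.val + 1) →
      ((∏ i, z i ^ (i.val + 1) : ℕ) : ℝ) < C * (((∏ p ∈ S, p) *
        ∏ p ∈ (∏ i, x i * y i * z i).primeFactors \ S, p ^ (∏ i, x i * y i * z i).factorization p : ℕ) :
          ℝ) ^ (1 + ε) := by
  intro h
  obtain ⟨C, hC, hK⟩ := h 1 1 one_pos
  obtain ⟨n, hn⟩ := exists_nat_gt (4 * C)
  have key := hK {2} (by simp) (by simp [Nat.prime_two]) ![2 ^ n, 1, 1, 1] ![2 ^ n, 1, 1, 1]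
    ![2 ^ (n + 1), 1, 1, 1] (by intro i; fin_cases i <;> simp) (by simp [Fin.prod_univ_four]; ring)
  have h1 : (∏ i : Fin 4, (![2 ^ (n + 1), 1, 1, 1] : Fin 4 → ℕ) i ^ (i.val + 1)) = 2 ^ (n + 1) := by
    simp [Fin.prod_univ_four]
  have h2 : (∏ i : Fin 4, (![2 ^ n, 1, 1, 1] : Fin 4 → ℕ) i * (![2 ^ n, 1, 1, 1] : Fin 4 → ℕ) i *
      (![2 ^ (n + 1), 1, 1, 1] : Fin 4 → ℕ) i) = 2 ^ (3 * n + 1) := by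
    simp [Fin.prod_univ_four]; ring
  rw [h1, h2, bracket_two_pow, show (1 : ℝ) + 1 = 2 by norm_num, Real.rpow_two] at key
  push_cast at key
  have h2n : (n : ℝ) < (2 : ℝ) ^ n := by exact_mod_cast Nat.lt_two_pow_self
  have : (2 : ℝ) ^ (n + 1) = 2 * 2 ^ n := by ring
  nlinarith

/-- **Primality of `S` is load-bearing, but only through `0 ∈ S`.** Without `∀ p ∈ S, p.Prime` the crux
fails at `K = 1`: `S = {0}` makes `∏_{p∈S} p = 0`, so the bracket is `0` and `2 < C·0^(1+ε) = 0` fails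
for the point `1 + 1 = 2`.  (Composite or unit members of `S` are harmless: they are never prime factors of
`M`, so they only enlarge the factor `∏_{p∈S} p`.) -/
theorem uniformSadicTowerFour_false_without_prime :
    ¬ ∀ K : ℕ, ∀ ε : ℝ, 0 < ε → ∃ C : ℝ, 0 < C ∧ ∀ S : Finset ℕ, S.card ≤ K →
      ∀ x y z : Fin 4 → ℕ, (∀ i, 0 < x i ∧ 0 < y i ∧ 0 < z i) →
      (∏ i, x i ^ (i.val + 1)) + (∏ i, y i ^ (i.val + 1)) = ∏ i, z i ^ (i.val + 1) →
      Nat.Coprime (∏ i, x i ^ (i.val + 1)) (∏ i, y i ^ (i.val + 1)) →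
      ((∏ i, z i ^ (i.val + 1) : ℕ) : ℝ) < C * (((∏ p ∈ S, p) *
        ∏ p ∈ (∏ i, x i * y i * z i).primeFactors \ S, p ^ (∏ i, x i * y i * z i).factorization p : ℕ) :
          ℝ) ^ (1 + ε) := by
  intro h
  obtain ⟨C, hC, hK⟩ := h 1 1 one_pos
  have key := hK {0} (by simp) ![1, 1, 1, 1] ![1, 1, 1, 1] ![2, 1, 1, 1]
    (by intro i; fin_cases i <;> simp) (by simp [Fin.prod_univ_four]) (by simp [Fin.prod_univ_four])
  rw [Finset.prod_singleton, zero_mul, show (1 : ℝ) + 1 = 2 by norm_num, Real.rpow_two] at key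
  simp [Fin.prod_univ_four] at key
  linarith

/-- **The equation is load-bearing.** Without `a + b = c` the crux fails at `K = 0`: `x = y = (1,1,1,1)`,
`z = (1,1,1,m)` has `c = m⁴`, `M = m`, bracket (`S = ∅`) `= m`, and `m⁴ < C·m²` fails for `m > C`. -/
theorem uniformSadicTowerFour_false_without_eq :
    ¬ ∀ K : ℕ, ∀ ε : ℝ, 0 < ε → ∃ C : ℝ, 0 < C ∧ ∀ S : Finset ℕ, S.card ≤ K → (∀ p ∈ S, Nat.Prime p) →
      ∀ x y z : Fin 4 → ℕ, (∀ i, 0 < x i ∧ 0 < y i ∧ 0 < z i) →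
      Nat.Coprime (∏ i, x i ^ (i.val + 1)) (∏ i, y i ^ (i.val + 1)) →
      ((∏ i, z i ^ (i.val + 1) : ℕ) : ℝ) < C * (((∏ p ∈ S, p) *
        ∏ p ∈ (∏ i, x i * y i * z i).primeFactors \ S, p ^ (∏ i, x i * y i * z i).factorization p : ℕ) :
          ℝ) ^ (1 + ε) := by
  intro h
  obtain ⟨C, hC, hK⟩ := h 0 1 one_pos
  obtain ⟨m, hm⟩ := exists_nat_gt C
  have hm0 : 0 < m := by exact_mod_cast hC.trans hm
  have key := hK ∅ (by simp) (by simp) ![1, 1, 1, 1] ![1, 1, 1, 1] ![1, 1, 1, m]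
    (by intro i; fin_cases i <;> simp [hm0]) (by simp [Fin.prod_univ_four])
  have h1 : (∏ i : Fin 4, (![1, 1, 1, m] : Fin 4 → ℕ) i ^ (i.val + 1)) = m ^ 4 := by
    simp [Fin.prod_univ_four]
  have h2 : (∏ i : Fin 4, (![1, 1, 1, 1] : Fin 4 → ℕ) i * (![1, 1, 1, 1] : Fin 4 → ℕ) i *
      (![1, 1, 1, m] : Fin 4 → ℕ) i) = m := by
    simp [Fin.prod_univ_four]
  rw [h1, h2, UniformSadicGivesTowerFour.bracket_empty hm0.ne', show (1 : ℝ) + 1 = 2 by norm_num,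
    Real.rpow_two] at key
  push_cast at key
  have hm1 : (1 : ℝ) ≤ m := by exact_mod_cast hm0
  have hmC : C * (m : ℝ) ^ 2 < (m : ℝ) ^ 4 := by
    have h3 : (0 : ℝ) ≤ (m : ℝ) ^ 3 := by positivity
    calc C * (m : ℝ) ^ 2 < m * (m : ℝ) ^ 2 := by gcongr
      _ = (m : ℝ) ^ 3 * 1 := by ring
      _ ≤ (m : ℝ) ^ 3 * m := mul_le_mul_of_nonneg_left hm1 h3
      _ = (m : ℝ) ^ 4 := by ring
  linarith

/-- If `S` consists of primes, the bracket is at least `1`. -/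
theorem one_le_bracket (M : ℕ) (S : Finset ℕ) (hS : ∀ p ∈ S, Nat.Prime p) :
    (1 : ℝ) ≤ (((∏ p ∈ S, p) * ∏ p ∈ M.primeFactors \ S, p ^ M.factorization p : ℕ) : ℝ) := by
  exact_mod_cast AbcGivesUniformSadic.sadic_pos M S hS

/-- **Positivity is NOT load-bearing.** The crux with the positivity hypothesis deleted is equivalent
to the crux: if some coordinate vanishes then `a = 0` or `b = 0` or `c = 0`, and coprimality with the
equation forces `c ≤ 1`, while the bracket of `M = 0` is `∏_{p∈S} p ≥ 1`; so the constant `max C 2`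
serves the degenerate points.  (Contrast `TowerFourSubLiouville`, where `Π = 0` makes positivity
load-bearing: there the right-hand side is `C·0^{A+ε} = 0`.) -/
theorem uniformSadicTowerFour_iff_without_pos :
    (∀ K : ℕ, ∀ ε : ℝ, 0 < ε → ∃ C : ℝ, 0 < C ∧ ∀ S : Finset ℕ, S.card ≤ K → (∀ p ∈ S, Nat.Prime p) →
      ∀ x y z : Fin 4 → ℕ,
      (∏ i, x i ^ (i.val + 1)) + (∏ i, y i ^ (i.val + 1)) = ∏ i, z i ^ (i.val + 1) →
      Nat.Coprime (∏ i, x i ^ (i.val + 1)) (∏ i, y i ^ (i.val + 1)) →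
      ((∏ i, z i ^ (i.val + 1) : ℕ) : ℝ) < C * (((∏ p ∈ S, p) *
        ∏ p ∈ (∏ i, x i * y i * z i).primeFactors \ S, p ^ (∏ i, x i * y i * z i).factorization p : ℕ) :
          ℝ) ^ (1 + ε)) ↔ UniformSadicTowerFour := by
  constructor
  · intro h K ε hε
    obtain ⟨C, hC, hK⟩ := h K ε hε
    exact ⟨C, hC, fun S hS hP x y z _ hsum hcop => hK S hS hP x y z hsum hcop⟩
  · intro h K ε hε
    obtain ⟨C, hC, hK⟩ := h K ε hε
    refine ⟨max C 2, lt_max_of_lt_left hC, fun S hS hP x y z hsum hcop => ?_⟩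
    have hB := one_le_bracket (∏ i, x i * y i * z i) S hP
    have hBpow : (1 : ℝ) ≤ (((∏ p ∈ S, p) * ∏ p ∈ (∏ i, x i * y i * z i).primeFactors \ S,
        p ^ (∏ i, x i * y i * z i).factorization p : ℕ) : ℝ) ^ (1 + ε) :=
      Real.one_le_rpow hB (by linarith)
    by_cases hpos : ∀ i, 0 < x i ∧ 0 < y i ∧ 0 < z i
    · calc ((∏ i, z i ^ (i.val + 1) : ℕ) : ℝ) < C * _ ^ (1 + ε) := hK S hS hP x y z hpos hsum hcop
        _ ≤ max C 2 * _ ^ (1 + ε) :=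
          mul_le_mul_of_nonneg_right (le_max_left _ _) (by positivity)
    · have hc1 : (∏ i, z i ^ (i.val + 1)) ≤ 1 := by
        push Not at hpos
        obtain ⟨i, hi⟩ := hpos
        by_cases hx : x i = 0
        · have ha : (∏ i, x i ^ (i.val + 1)) = 0 :=
            Finset.prod_eq_zero (Finset.mem_univ i) (by simp [hx])
          rw [ha] at hcop hsum
          have hb : (∏ i, y i ^ (i.val + 1)) = 1 := Nat.coprime_zero_left _ |>.mp hcop
          omega
        by_cases hy : y i = 0
        · have hb : (∏ i, y i ^ (i.val + 1)) = 0 :=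
            Finset.prod_eq_zero (Finset.mem_univ i) (by simp [hy])
          rw [hb] at hcop hsum
          have ha : (∏ i, x i ^ (i.val + 1)) = 1 := Nat.coprime_zero_right _ |>.mp hcop
          omega
        · have hz : z i = 0 := by
            have := hi (Nat.pos_of_ne_zero hx) (Nat.pos_of_ne_zero hy); omega
          have hc : (∏ i, z i ^ (i.val + 1)) = 0 :=
            Finset.prod_eq_zero (Finset.mem_univ i) (by simp [hz])
          omega
      calc ((∏ i, z i ^ (i.val + 1) : ℕ) : ℝ) ≤ 1 := by exact_mod_cast hc1
        _ < 2 * 1 := by norm_num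
        _ ≤ max C 2 * _ ^ (1 + ε) := mul_le_mul (le_max_right _ _) hBpow zero_le_one (by positivity)

/-! ## (b) Tightness: `ε` cannot be dropped (already at `K = 0`) -/

/-- **`ε = 0` is false.** There are no constants `C(K)` with `c < C(K)·bracket` (exponent exactly `1`):
at `K = 0`, `S = ∅` the bracket is `M = ∏ xᵢyᵢzᵢ`, and `Negative.DialCalibration.not_towerIneq4OneNoEps`
(Pell `u² − 3v² = 1` with Matiyasevich's `y_N² ∣ y_{N y_N}`: `c/M ≥ N/3`) refutes `c < C·M`. -/
theorem uniformSadicTowerFour_false_without_eps :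
    ¬ ∀ K : ℕ, ∃ C : ℝ, 0 < C ∧ ∀ S : Finset ℕ, S.card ≤ K → (∀ p ∈ S, Nat.Prime p) →
      ∀ x y z : Fin 4 → ℕ, (∀ i, 0 < x i ∧ 0 < y i ∧ 0 < z i) →
      (∏ i, x i ^ (i.val + 1)) + (∏ i, y i ^ (i.val + 1)) = ∏ i, z i ^ (i.val + 1) →
      Nat.Coprime (∏ i, x i ^ (i.val + 1)) (∏ i, y i ^ (i.val + 1)) →
      ((∏ i, z i ^ (i.val + 1) : ℕ) : ℝ) < C * (((∏ p ∈ S, p) *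
        ∏ p ∈ (∏ i, x i * y i * z i).primeFactors \ S, p ^ (∏ i, x i * y i * z i).factorization p : ℕ) :
          ℝ) := by
  intro h
  obtain ⟨C, hC, hK⟩ := h 0
  refine not_towerIneq4OneNoEps ⟨C, hC, fun x y z hpos hsum hcop => ?_⟩
  have hM : (∏ i, x i * y i * z i) ≠ 0 :=
    (Finset.prod_pos fun i _ =>
      Nat.mul_pos (Nat.mul_pos (hpos i).1 (hpos i).2.1) (hpos i).2.2).ne'
  have key := hK ∅ (by simp) (by simp) x y z hpos hsum hcop
  rwa [UniformSadicGivesTowerFour.bracket_empty hM] at key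

/-- **Even a logarithmic loss fails at `K = 0`.** For every `A < 1` there is no `C` with
`c ≤ C·bracket·(log c)^A` at `S = ∅` (from `Negative.LogLoss.not_towerIneq4One_logLoss`). -/
theorem uniformSadicTowerFour_false_logLoss (A : ℝ) (hA : A < 1) :
    ¬ ∃ C : ℝ, ∀ x y z : Fin 4 → ℕ, (∀ i, 0 < x i ∧ 0 < y i ∧ 0 < z i) →
      (∏ i, x i ^ (i.val + 1)) + (∏ i, y i ^ (i.val + 1)) = ∏ i, z i ^ (i.val + 1) →
      Nat.Coprime (∏ i, x i ^ (i.val + 1)) (∏ i, y i ^ (i.val + 1)) →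
      ((∏ i, z i ^ (i.val + 1) : ℕ) : ℝ) ≤ C * (((∏ p ∈ (∅ : Finset ℕ), p) *
        ∏ p ∈ (∏ i, x i * y i * z i).primeFactors \ ∅, p ^ (∏ i, x i * y i * z i).factorization p : ℕ) :
          ℝ) * Real.log (((∏ i, z i ^ (i.val + 1) : ℕ) : ℝ)) ^ A := by
  rintro ⟨C, h⟩
  refine not_towerIneq4One_logLoss A hA ⟨C, fun x y z hpos hsum hcop => ?_⟩
  have hM : (∏ i, x i * y i * z i) ≠ 0 :=
    (Finset.prod_pos fun i _ =>
      Nat.mul_pos (Nat.mul_pos (hpos i).1 (hpos i).2.1) (hpos i).2.2).ne'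
  have key := h x y z hpos hsum hcop
  rwa [UniformSadicGivesTowerFour.bracket_empty hM] at key

/-! ## (c) The `S`-loss: the factor `∏_{p∈S} p` cannot be dropped, nor its exponent taken below `1/2` (modulo bounded prime gaps) -/

/-- **`S`-free parts see only the cofactor.** If every prime factor of `u` lies in `S`, then the
`S`-free part of `u·v` divides `v`. [folklore] -/
theorem sfree_dvd {u v : ℕ} {S : Finset ℕ} (hu0 : u ≠ 0) (hv0 : v ≠ 0) (hu : u.primeFactors ⊆ S) :
    (∏ r ∈ (u * v).primeFactors \ S, r ^ (u * v).factorization r) ∣ v := by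
  have h1 : ∀ r ∈ (u * v).primeFactors \ S, (u * v).factorization r = v.factorization r := by
    intro r hr
    rw [Finset.mem_sdiff] at hr
    have hur : u.factorization r = 0 := by
      apply Nat.factorization_eq_zero_of_not_dvd
      intro hdvd
      exact hr.2 (hu (Nat.mem_primeFactors.mpr ⟨(Nat.mem_primeFactors.mp hr.1).1, hdvd, hu0⟩))
    rw [Nat.factorization_mul hu0 hv0, Finsupp.add_apply, hur, zero_add]
  have h2 : (u * v).primeFactors \ S ⊆ v.primeFactors := by
    intro r hr
    rw [Finset.mem_sdiff] at hr
    have hr' := Nat.mem_primeFactors.mp hr.1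
    rcases (Nat.Prime.dvd_mul hr'.1).mp hr'.2.1 with hdu | hdv
    · exact absurd (hu (Nat.mem_primeFactors.mpr ⟨hr'.1, hdu, hu0⟩)) hr.2
    · exact Nat.mem_primeFactors.mpr ⟨hr'.1, hdv, hv0⟩
  calc (∏ r ∈ (u * v).primeFactors \ S, r ^ (u * v).factorization r)
      = ∏ r ∈ (u * v).primeFactors \ S, r ^ v.factorization r :=
        Finset.prod_congr rfl fun r hr => by rw [h1 r hr]
    _ ∣ ∏ r ∈ v.primeFactors, r ^ v.factorization r := Finset.prod_dvd_prod_of_subset _ _ _ h2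
    _ = v := by
        conv_rhs => rw [← Nat.prod_factorization_pow_eq_self hv0,
          Nat.prod_factorization_eq_prod_primeFactors]

/-- The prime factors of a product of two primes. [folklore] -/
theorem primeFactors_prime_mul_prime {p q : ℕ} (hp : p.Prime) (hq : q.Prime) :
    (p * q).primeFactors ⊆ {p, q} := by
  rw [Nat.primeFactors_mul hp.ne_zero hq.ne_zero, hp.primeFactors, hq.primeFactors]
  intro r hr
  simp only [Finset.mem_union, Finset.mem_singleton] at hr
  simp only [Finset.mem_insert, Finset.mem_singleton]
  exact hr

/-- **The `S`-factor cannot be dropped (at `K = 2`), modulo bounded gaps between primes.**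
Hypothesis `H` (inlined): there is `B` such that beyond every `N` there are primes `p < q ≤ p + B`
(Zhang 2014; Maynard 2015; Polymath 8b, `B = 246` — not in Mathlib).  Then the crux with the factor
`∏_{p∈S} p` deleted from the bracket is false: the point `p + (q − p) = q` (trivial lifts) with
`S = {p, q}` has `S`-free part `∣ q − p ≤ B` (`sfree_dvd`), so `q < C·B²` fails for large `q`.
[cite: ZhangAnnals2014, Thm 1] [cite: MaynardAnnals2015, Thm 1.1] [cite: Polymath8b2014] -/
theorem uniformSadicTowerFour_noSFactor_false_of_boundedGaps
    (hgaps : ∃ B : ℕ, ∀ N : ℕ, ∃ p q : ℕ, N ≤ p ∧ p < q ∧ q ≤ p + B ∧ p.Prime ∧ q.Prime) :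
    ¬ ∀ K : ℕ, ∀ ε : ℝ, 0 < ε → ∃ C : ℝ, 0 < C ∧ ∀ S : Finset ℕ, S.card ≤ K → (∀ p ∈ S, Nat.Prime p) →
      ∀ x y z : Fin 4 → ℕ, (∀ i, 0 < x i ∧ 0 < y i ∧ 0 < z i) →
      (∏ i, x i ^ (i.val + 1)) + (∏ i, y i ^ (i.val + 1)) = ∏ i, z i ^ (i.val + 1) →
      Nat.Coprime (∏ i, x i ^ (i.val + 1)) (∏ i, y i ^ (i.val + 1)) →
      ((∏ i, z i ^ (i.val + 1) : ℕ) : ℝ) < C * ((∏ p ∈ (∏ i, x i * y i * z i).primeFactors \ S,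
        p ^ (∏ i, x i * y i * z i).factorization p : ℕ) : ℝ) ^ (1 + ε) := by
  obtain ⟨B, hB⟩ := hgaps
  intro h
  obtain ⟨C, hC, hK⟩ := h 2 1 one_pos
  obtain ⟨N, hN⟩ := exists_nat_gt (max (B : ℝ) (C * (B : ℝ) ^ 2))
  obtain ⟨p, q, hNp, hpq, hqB, hp, hq⟩ := hB N
  obtain ⟨g, rfl⟩ : ∃ g, q = p + g := ⟨q - p, by omega⟩
  have hg0 : 0 < g := by omega
  have hgB : g ≤ B := by omega
  have hBN : (B : ℝ) < N := lt_of_le_of_lt (le_max_left _ _) hN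
  have hCN : C * (B : ℝ) ^ 2 < N := lt_of_le_of_lt (le_max_right _ _) hN
  have hBp : B < p := by
    have : (B : ℝ) < p := hBN.trans_le (by exact_mod_cast hNp)
    exact_mod_cast this
  have hcop : Nat.Coprime p g :=
    (Nat.Prime.coprime_iff_not_dvd hp).mpr (Nat.not_dvd_of_pos_of_lt hg0 (by omega))
  have hne : p ≠ p + g := by omega
  have key := hK {p, p + g} (by rw [Finset.card_pair hne])
    (by intro r hr
        simp only [Finset.mem_insert, Finset.mem_singleton] at hr
        rcases hr with rfl | rfl
        · exact hp
        · exact hq)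
    ![p, 1, 1, 1] ![g, 1, 1, 1] ![p + g, 1, 1, 1]
    (by intro i; fin_cases i <;> simp [hp.pos, hg0])
    (by simp [Fin.prod_univ_four]) (by simpa [Fin.prod_univ_four] using hcop)
  have h1 : (∏ i : Fin 4, (![p + g, 1, 1, 1] : Fin 4 → ℕ) i ^ (i.val + 1)) = p + g := by
    simp [Fin.prod_univ_four]
  have h2 : (∏ i : Fin 4, (![p, 1, 1, 1] : Fin 4 → ℕ) i * (![g, 1, 1, 1] : Fin 4 → ℕ) i *
      (![p + g, 1, 1, 1] : Fin 4 → ℕ) i) = p * (p + g) * g := by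
    simp [Fin.prod_univ_four]; ring
  rw [h1, h2, show (1 : ℝ) + 1 = 2 by norm_num, Real.rpow_two] at key
  have hdvd := sfree_dvd (S := {p, p + g}) (Nat.mul_ne_zero hp.ne_zero hq.ne_zero) hg0.ne'
    (primeFactors_prime_mul_prime hp hq)
  have hle : ((∏ r ∈ (p * (p + g) * g).primeFactors \ {p, p + g},
      r ^ (p * (p + g) * g).factorization r : ℕ) : ℝ) ≤ B := by
    exact_mod_cast (Nat.le_of_dvd hg0 hdvd).trans hgB
  have hsf0 : (0 : ℝ) ≤ ((∏ r ∈ (p * (p + g) * g).primeFactors \ {p, p + g},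
      r ^ (p * (p + g) * g).factorization r : ℕ) : ℝ) := Nat.cast_nonneg _
  have hq' : (N : ℝ) ≤ ((p + g : ℕ) : ℝ) := by exact_mod_cast hNp.trans (Nat.le_add_right p g)
  have : C * (((∏ r ∈ (p * (p + g) * g).primeFactors \ {p, p + g},
      r ^ (p * (p + g) * g).factorization r : ℕ) : ℝ)) ^ 2 ≤ C * (B : ℝ) ^ 2 := by
    gcongr
  linarith

/-- **The `S`-exponent cannot go below `1/2`, modulo bounded gaps between primes.** With the factor
`∏_{p∈S} p` of the bracket replaced by `(∏_{p∈S} p)^θ`, `0 ≤ θ < 1/2`, the crux is false (at `K = 2`),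
given bounded prime gaps: the same point `p + (q−p) = q`, `S = {p,q}`, has right-hand side
`≤ C·((pq)^θ·B)^{1+ε} ≤ C·B^{1+ε}·q^{2θ(1+ε)}`, and `2θ(1+ε) < 1` for `ε = (1 − 2θ)/2`.
(Baker–Harman–Pintz primes in `[x, x + x^{0.525}]` [cite: BakerHarmanPintz2001] alone give `θ > 0.2375` via `(p², q²−p², q²)`;
`θ ∈ [1/2, 1)` is forced only heuristically, by primes `2^a3^b + 1` with `S = {2,3,p}`.)
[cite: ZhangAnnals2014, Thm 1] [cite: MaynardAnnals2015, Thm 1.1] [cite: Polymath8b2014] -/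
theorem uniformSadicTowerFour_subsqrtSLoss_false_of_boundedGaps
    (hgaps : ∃ B : ℕ, ∀ N : ℕ, ∃ p q : ℕ, N ≤ p ∧ p < q ∧ q ≤ p + B ∧ p.Prime ∧ q.Prime)
    (θ : ℝ) (hθ0 : 0 ≤ θ) (hθ : θ < 1 / 2) :
    ¬ ∀ K : ℕ, ∀ ε : ℝ, 0 < ε → ∃ C : ℝ, 0 < C ∧ ∀ S : Finset ℕ, S.card ≤ K → (∀ p ∈ S, Nat.Prime p) →
      ∀ x y z : Fin 4 → ℕ, (∀ i, 0 < x i ∧ 0 < y i ∧ 0 < z i) →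
      (∏ i, x i ^ (i.val + 1)) + (∏ i, y i ^ (i.val + 1)) = ∏ i, z i ^ (i.val + 1) →
      Nat.Coprime (∏ i, x i ^ (i.val + 1)) (∏ i, y i ^ (i.val + 1)) →
      ((∏ i, z i ^ (i.val + 1) : ℕ) : ℝ) < C * ((∏ p ∈ S, (p : ℝ)) ^ θ *
        ((∏ p ∈ (∏ i, x i * y i * z i).primeFactors \ S,
          p ^ (∏ i, x i * y i * z i).factorization p : ℕ) : ℝ)) ^ (1 + ε) := by
  obtain ⟨B, hB⟩ := hgaps
  intro h
  set ε : ℝ := (1 - 2 * θ) / 2 with hε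
  have hε0 : 0 < ε := by rw [hε]; linarith
  set s : ℝ := 2 * θ * (1 + ε) with hs
  have hs1 : s < 1 := by
    rw [hs, hε]; nlinarith
  obtain ⟨C, hC, hK⟩ := h 2 ε hε0
  obtain ⟨M, hM1, hM⟩ := key_growth (K := C * (B : ℝ) ^ (1 + ε)) (by positivity) hs1
  obtain ⟨N, hN⟩ := exists_nat_gt (max (B : ℝ) M)
  obtain ⟨p, q, hNp, hpq, hqB, hp, hq⟩ := hB N
  obtain ⟨g, rfl⟩ : ∃ g, q = p + g := ⟨q - p, by omega⟩
  have hg0 : 0 < g := by omega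
  have hgB : g ≤ B := by omega
  have hBN : (B : ℝ) < N := lt_of_le_of_lt (le_max_left _ _) hN
  have hMN : M < N := lt_of_le_of_lt (le_max_right _ _) hN
  have hBp : B < p := by
    have : (B : ℝ) < p := hBN.trans_le (by exact_mod_cast hNp)
    exact_mod_cast this
  have hcop : Nat.Coprime p g :=
    (Nat.Prime.coprime_iff_not_dvd hp).mpr (Nat.not_dvd_of_pos_of_lt hg0 (by omega))
  have hne : p ≠ p + g := by omega
  have key := hK {p, p + g} (by rw [Finset.card_pair hne])
    (by intro r hr
        simp only [Finset.mem_insert, Finset.mem_singleton] at hr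
        rcases hr with rfl | rfl
        · exact hp
        · exact hq)
    ![p, 1, 1, 1] ![g, 1, 1, 1] ![p + g, 1, 1, 1]
    (by intro i; fin_cases i <;> simp [hp.pos, hg0])
    (by simp [Fin.prod_univ_four]) (by simpa [Fin.prod_univ_four] using hcop)
  have h1 : (∏ i : Fin 4, (![p + g, 1, 1, 1] : Fin 4 → ℕ) i ^ (i.val + 1)) = p + g := by
    simp [Fin.prod_univ_four]
  have h2 : (∏ i : Fin 4, (![p, 1, 1, 1] : Fin 4 → ℕ) i * (![g, 1, 1, 1] : Fin 4 → ℕ) i *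
      (![p + g, 1, 1, 1] : Fin 4 → ℕ) i) = p * (p + g) * g := by
    simp [Fin.prod_univ_four]; ring
  rw [h1, h2, Finset.prod_pair hne] at key
  -- the S-free part is at most B
  have hdvd := sfree_dvd (S := {p, p + g}) (Nat.mul_ne_zero hp.ne_zero hq.ne_zero) hg0.ne'
    (primeFactors_prime_mul_prime hp hq)
  have hle : ((∏ r ∈ (p * (p + g) * g).primeFactors \ {p, p + g},
      r ^ (p * (p + g) * g).factorization r : ℕ) : ℝ) ≤ B := by
    exact_mod_cast (Nat.le_of_dvd hg0 hdvd).trans hgB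
  set F : ℝ := ((∏ r ∈ (p * (p + g) * g).primeFactors \ {p, p + g},
      r ^ (p * (p + g) * g).factorization r : ℕ) : ℝ) with hF
  have hF0 : 0 ≤ F := Nat.cast_nonneg _
  -- abbreviate T = q
  set T : ℝ := ((p + g : ℕ) : ℝ) with hT
  have hT1 : (1 : ℝ) ≤ T := by
    have h2p : 1 ≤ p + g := by have := hp.two_le; omega
    rw [hT]; exact_mod_cast h2p
  have hT0 : 0 < T := by linarith
  have hpT : (p : ℝ) ≤ T := by rw [hT]; exact_mod_cast Nat.le_add_right p g
  have hMT : M ≤ T := by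
    rw [hT]; exact hMN.le.trans (by exact_mod_cast hNp.trans (Nat.le_add_right p g))
  -- bound the bracket: (p*T)^θ * F ≤ T^(2θ) * B
  have hbase : ((p : ℝ) * T) ^ θ * F ≤ T ^ (2 * θ) * B := by
    have h1' : ((p : ℝ) * T) ^ θ ≤ (T * T) ^ θ :=
      Real.rpow_le_rpow (by positivity) (mul_le_mul_of_nonneg_right hpT hT0.le) hθ0
    have h2' : (T * T) ^ θ = T ^ (2 * θ) := by
      rw [show T * T = T ^ (2:ℝ) by rw [Real.rpow_two]; ring, ← Real.rpow_mul hT0.le]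
    rw [← h2']
    exact mul_le_mul h1' hle hF0 (Real.rpow_nonneg (by positivity) _)
  have hbase0 : 0 ≤ ((p : ℝ) * T) ^ θ * F := mul_nonneg (Real.rpow_nonneg (by positivity) _) hF0
  have hrhs : C * (((p : ℝ) * T) ^ θ * F) ^ (1 + ε) ≤ C * (B : ℝ) ^ (1 + ε) * T ^ s := by
    have h3 : (((p : ℝ) * T) ^ θ * F) ^ (1 + ε) ≤ (T ^ (2 * θ) * B) ^ (1 + ε) :=
      Real.rpow_le_rpow hbase0 hbase (by linarith)
    have h4 : (T ^ (2 * θ) * (B : ℝ)) ^ (1 + ε) = (B : ℝ) ^ (1 + ε) * T ^ s := by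
      rw [Real.mul_rpow (Real.rpow_nonneg hT0.le _) (Nat.cast_nonneg B), ← Real.rpow_mul hT0.le, hs]
      ring_nf
    calc C * (((p : ℝ) * T) ^ θ * F) ^ (1 + ε) ≤ C * (T ^ (2 * θ) * B) ^ (1 + ε) :=
          mul_le_mul_of_nonneg_left h3 hC.le
      _ = C * (B : ℝ) ^ (1 + ε) * T ^ s := by rw [h4]; ring
  have hgrow := hM T hMT
  -- key : T < C * ((p * T) ^ θ * F) ^ (1 + ε)
  have hkey : T < C * (((p : ℝ) * T) ^ θ * F) ^ (1 + ε) := by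
    have := key
    simpa [hT, hF, Nat.cast_add] using this
  linarith

/-- The `S`-free part of an `S`-unit is `1`. [folklore] -/
theorem sfree_eq_one_of_subset {M : ℕ} {S : Finset ℕ} (h : M.primeFactors ⊆ S) :
    (∏ r ∈ M.primeFactors \ S, r ^ M.factorization r) = 1 := by
  rw [Finset.sdiff_eq_empty_iff_subset.mpr h, Finset.prod_empty]

/-- **The linear `S`-loss is forced, modulo smooth shifted primes.** Let `S₀` be a finite set of primes such
that there are infinitely many primes `p` with `(p − 1).primeFactors ⊆ S₀` (for `S₀ = {2,3}`: infinitely many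
Pierpont primes).  Then for every `0 ≤ θ < 1` the crux with `(∏_{p∈S} p)^θ` in place of `∏_{p∈S} p` fails at
budget `K = S₀.card + 1`: the point `1 + (p−1) = p`, `S = insert p S₀`, has `S`-free part `1` and
`p < C·(p·∏_{S₀} q)^{θ(1+ε)}` fails for large `p` once `θ(1+ε) < 1`. -/
theorem uniformSadicTowerFour_sublinearSLoss_false_of_smoothShiftedPrimes
    (S₀ : Finset ℕ) (hS₀ : ∀ q ∈ S₀, Nat.Prime q)
    (hinf : ∀ N : ℕ, ∃ p : ℕ, N ≤ p ∧ p.Prime ∧ (p - 1).primeFactors ⊆ S₀)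
    (θ : ℝ) (hθ0 : 0 ≤ θ) (hθ : θ < 1) :
    ¬ ∀ K : ℕ, ∀ ε : ℝ, 0 < ε → ∃ C : ℝ, 0 < C ∧ ∀ S : Finset ℕ, S.card ≤ K → (∀ p ∈ S, Nat.Prime p) →
      ∀ x y z : Fin 4 → ℕ, (∀ i, 0 < x i ∧ 0 < y i ∧ 0 < z i) →
      (∏ i, x i ^ (i.val + 1)) + (∏ i, y i ^ (i.val + 1)) = ∏ i, z i ^ (i.val + 1) →
      Nat.Coprime (∏ i, x i ^ (i.val + 1)) (∏ i, y i ^ (i.val + 1)) →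
      ((∏ i, z i ^ (i.val + 1) : ℕ) : ℝ) < C * ((∏ p ∈ S, (p : ℝ)) ^ θ *
        ((∏ p ∈ (∏ i, x i * y i * z i).primeFactors \ S,
          p ^ (∏ i, x i * y i * z i).factorization p : ℕ) : ℝ)) ^ (1 + ε) := by
  intro h
  set ε : ℝ := (1 - θ) / 2 with hε
  have hε0 : 0 < ε := by rw [hε]; linarith
  set s : ℝ := θ * (1 + ε) with hs
  have hs1 : s < 1 := by rw [hs, hε]; nlinarith
  set P : ℝ := ∏ q ∈ S₀, (q : ℝ) with hP
  have hP1 : 1 ≤ P := by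
    rw [hP, ← Nat.cast_prod]
    exact_mod_cast Finset.prod_pos fun q hq => (hS₀ q hq).pos
  obtain ⟨C, hC, hK⟩ := h (S₀.card + 1) ε hε0
  obtain ⟨M, hM1, hM⟩ := key_growth (K := C * P ^ s) (by positivity) hs1
  obtain ⟨N, hN⟩ := exists_nat_gt M
  obtain ⟨p, hNp, hp, hsmooth⟩ := hinf N
  obtain ⟨m, rfl⟩ : ∃ m, p = m + 1 := ⟨p - 1, by have := hp.one_lt; omega⟩
  rw [Nat.add_sub_cancel] at hsmooth
  have hm0 : 0 < m := by have := hp.one_lt; omega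
  -- the point 1 + m = m + 1 with S = insert (m+1) S₀
  have hcard : (insert (m + 1) S₀).card ≤ S₀.card + 1 := Finset.card_insert_le _ _
  have hprime : ∀ q ∈ insert (m + 1) S₀, Nat.Prime q := by
    intro q hq
    rcases Finset.mem_insert.mp hq with rfl | hq
    · exact hp
    · exact hS₀ q hq
  have key := hK (insert (m + 1) S₀) hcard hprime ![1, 1, 1, 1] ![m, 1, 1, 1] ![m + 1, 1, 1, 1]
    (by intro i; fin_cases i <;> simp [hm0])
    (by simp [Fin.prod_univ_four]; ring) (by simp [Fin.prod_univ_four])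
  have h1 : (∏ i : Fin 4, (![m + 1, 1, 1, 1] : Fin 4 → ℕ) i ^ (i.val + 1)) = m + 1 := by
    simp [Fin.prod_univ_four]
  have h2 : (∏ i : Fin 4, (![1, 1, 1, 1] : Fin 4 → ℕ) i * (![m, 1, 1, 1] : Fin 4 → ℕ) i *
      (![m + 1, 1, 1, 1] : Fin 4 → ℕ) i) = m * (m + 1) := by
    simp [Fin.prod_univ_four]
  -- the S-free part is 1
  have hsub : (m * (m + 1)).primeFactors ⊆ insert (m + 1) S₀ := by
    rw [Nat.primeFactors_mul hm0.ne' hp.ne_zero, hp.primeFactors]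
    intro r hr
    rcases Finset.mem_union.mp hr with hr | hr
    · exact Finset.mem_insert_of_mem (hsmooth hr)
    · rw [Finset.mem_singleton] at hr; rw [hr]; exact Finset.mem_insert_self _ _
  rw [h1, h2, sfree_eq_one_of_subset hsub] at key
  set p : ℕ := m + 1 with hpdef
  have hp1 : 1 ≤ p := hp.one_lt.le
  -- the S-product is at most p * P
  have hprod : (∏ q ∈ insert p S₀, (q : ℝ)) ≤ p * P := by
    by_cases hpS : p ∈ S₀
    · rw [Finset.insert_eq_of_mem hpS, ← hP]
      have hp1' : (1 : ℝ) ≤ p := by exact_mod_cast hp1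
      calc P = 1 * P := (one_mul P).symm
        _ ≤ p * P := mul_le_mul_of_nonneg_right hp1' (by linarith)
    · rw [Finset.prod_insert hpS]
  have hprod0 : (0 : ℝ) ≤ ∏ q ∈ insert p S₀, (q : ℝ) :=
    Finset.prod_nonneg fun q _ => Nat.cast_nonneg q
  have hp0 : (0 : ℝ) < p := by exact_mod_cast hp.pos
  -- RHS ≤ C * P^s * p^s
  have hrhs : C * ((∏ q ∈ insert p S₀, (q : ℝ)) ^ θ * ((1 : ℕ) : ℝ)) ^ (1 + ε) ≤
      C * P ^ s * (p : ℝ) ^ s := by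
    have h3 : (∏ q ∈ insert p S₀, (q : ℝ)) ^ θ * ((1 : ℕ) : ℝ) ≤ ((p : ℝ) * P) ^ θ := by
      rw [Nat.cast_one, mul_one]
      exact Real.rpow_le_rpow hprod0 hprod hθ0
    have h30 : (0 : ℝ) ≤ (∏ q ∈ insert p S₀, (q : ℝ)) ^ θ * ((1 : ℕ) : ℝ) := by
      rw [Nat.cast_one, mul_one]; exact Real.rpow_nonneg hprod0 _
    have h4 : ((∏ q ∈ insert p S₀, (q : ℝ)) ^ θ * ((1 : ℕ) : ℝ)) ^ (1 + ε) ≤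
        (((p : ℝ) * P) ^ θ) ^ (1 + ε) := Real.rpow_le_rpow h30 h3 (by linarith)
    have h5 : (((p : ℝ) * P) ^ θ) ^ (1 + ε) = P ^ s * (p : ℝ) ^ s := by
      rw [← Real.rpow_mul (by positivity), ← hs, Real.mul_rpow hp0.le (by linarith)]
      ring
    calc C * ((∏ q ∈ insert p S₀, (q : ℝ)) ^ θ * ((1 : ℕ) : ℝ)) ^ (1 + ε)
        ≤ C * (((p : ℝ) * P) ^ θ) ^ (1 + ε) := mul_le_mul_of_nonneg_left h4 hC.le
      _ = C * P ^ s * (p : ℝ) ^ s := by rw [h5]; ring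
  have hMp : M ≤ (p : ℝ) := hN.le.trans (by exact_mod_cast hNp)
  have hgrow := hM (p : ℝ) hMp
  have hkey : ((p : ℕ) : ℝ) < C * ((∏ q ∈ insert p S₀, (q : ℝ)) ^ θ * ((1 : ℕ) : ℝ)) ^ (1 + ε) := key
  linarith

/-! ## (d) Constants: with `C = 1`, the exponent must exceed `39/25` at `K = 1` and `81/50` at `K = 2` -/

/-- **The record point at `K = 1`.** `1 + 4374 = 4375` (`4374 = 2·3⁷`, `4375 = 5⁴·7`) lifted optimally as
`x = (1,1,1,1)`, `y = (2,1,3,3)`, `z = (7,1,1,5)` has `M = 630 = 3²·70`; at `S = {3}` the bracket is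
`3·{630}^{{3}} = 210 = rad(abc)` (the level-4 overcharge `3²` of `3⁷` is discounted), and
`210^{39/25} < 4375` (`K = 1`-discounted tower quality `log 4375 / log 210 = 1.5679`, the abc quality). -/
theorem quality_point_4375_at_three :
    ∃ x y z : Fin 4 → ℕ, (∀ i, 0 < x i ∧ 0 < y i ∧ 0 < z i) ∧
      (∏ i, x i ^ (i.val + 1)) + (∏ i, y i ^ (i.val + 1)) = ∏ i, z i ^ (i.val + 1) ∧
      Nat.Coprime (∏ i, x i ^ (i.val + 1)) (∏ i, y i ^ (i.val + 1)) ∧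
      ((∏ i, z i ^ (i.val + 1) : ℕ) : ℝ) = 4375 ∧
      (((∏ p ∈ ({3} : Finset ℕ), p) * ∏ p ∈ (∏ i, x i * y i * z i).primeFactors \ {3},
        p ^ (∏ i, x i * y i * z i).factorization p : ℕ) : ℝ) ≤ 210 ∧
      (210 : ℝ) ^ ((39 : ℝ) / 25) < 4375 := by
  refine ⟨![1, 1, 1, 1], ![2, 1, 3, 3], ![7, 1, 1, 5], ?_, by decide, by decide, ?_, ?_, ?_⟩
  · intro i; fin_cases i <;> simp
  · simp [Fin.prod_univ_four]
  · have hM : (∏ i : Fin 4, (![1, 1, 1, 1] : Fin 4 → ℕ) i * (![2, 1, 3, 3] : Fin 4 → ℕ) i *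
        (![7, 1, 1, 5] : Fin 4 → ℕ) i) = 9 * 70 := by
      simp [Fin.prod_univ_four]
    rw [hM, Finset.prod_singleton]
    have h9 : (9 : ℕ).primeFactors ⊆ {3} := by
      rw [show (9 : ℕ) = 3 ^ 2 by norm_num, Nat.primeFactors_prime_pow (by norm_num) Nat.prime_three]
    have hdvd := sfree_dvd (u := 9) (v := 70) (S := {3}) (by norm_num) (by norm_num) h9
    have h70 : (∏ r ∈ (9 * 70).primeFactors \ {3}, r ^ (9 * 70).factorization r) ≤ 70 :=
      Nat.le_of_dvd (by norm_num) hdvd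
    have : (3 * ∏ r ∈ (9 * 70).primeFactors \ {3}, r ^ (9 * 70).factorization r) ≤ 210 := by omega
    exact_mod_cast this
  · refine lt_of_pow_lt_pow_left₀ 25 (by norm_num) ?_
    rw [← Real.rpow_natCast, ← Real.rpow_mul (by norm_num)]
    norm_num

/-- Hence at budget `K = 1` the crux inequality with constant `C = 1` needs exponent `> 39/25`:
`c < 1·bracket^{39/25}` fails at the point above with `S = {3}`. -/
theorem not_uniformSadicTowerFour_one_constant_one_exponent_39_25 :
    ¬ ∀ S : Finset ℕ, S.card ≤ 1 → (∀ p ∈ S, Nat.Prime p) →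
      ∀ x y z : Fin 4 → ℕ, (∀ i, 0 < x i ∧ 0 < y i ∧ 0 < z i) →
      (∏ i, x i ^ (i.val + 1)) + (∏ i, y i ^ (i.val + 1)) = ∏ i, z i ^ (i.val + 1) →
      Nat.Coprime (∏ i, x i ^ (i.val + 1)) (∏ i, y i ^ (i.val + 1)) →
      ((∏ i, z i ^ (i.val + 1) : ℕ) : ℝ) < 1 * (((∏ p ∈ S, p) *
        ∏ p ∈ (∏ i, x i * y i * z i).primeFactors \ S, p ^ (∏ i, x i * y i * z i).factorization p : ℕ) :
          ℝ) ^ ((39 : ℝ) / 25) := by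
  intro h
  obtain ⟨x, y, z, hpos, heq, hcop, hc, hB, hlt⟩ := quality_point_4375_at_three
  have key := h {3} (by simp) (by simp [Nat.prime_three]) x y z hpos heq hcop
  rw [hc, one_mul] at key
  have hmono : (((∏ p ∈ ({3} : Finset ℕ), p) * ∏ p ∈ (∏ i, x i * y i * z i).primeFactors \ {3},
      p ^ (∏ i, x i * y i * z i).factorization p : ℕ) : ℝ) ^ ((39 : ℝ) / 25) ≤
      (210 : ℝ) ^ ((39 : ℝ) / 25) :=
    Real.rpow_le_rpow (Nat.cast_nonneg _) hB (by norm_num)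
  linarith

/-- **The record point at `K = 2` (Reyssat).** `2 + 3¹⁰·109 = 23⁵` lifted optimally as `x = (2,1,1,1)`,
`y = (109,3,1,9)` (`109·3²·9⁴ = 3¹⁰·109`), `z = (23,1,1,23)` (`23·23⁴ = 23⁵`) has
`M = 3113694 = (3³·23²)·218`; at `S = {3, 23}` the bracket is `69·{M}^S = 69·218 = 15042 = rad(abc)`
(both level-4 overcharges discounted), and `15042^{81/50} < 6436343` (`K = 2`-discounted tower quality
`= abc quality 1.6299`, the record). -/
theorem quality_point_reyssat_at_three_twentythree :
    ∃ x y z : Fin 4 → ℕ, (∀ i, 0 < x i ∧ 0 < y i ∧ 0 < z i) ∧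
      (∏ i, x i ^ (i.val + 1)) + (∏ i, y i ^ (i.val + 1)) = ∏ i, z i ^ (i.val + 1) ∧
      Nat.Coprime (∏ i, x i ^ (i.val + 1)) (∏ i, y i ^ (i.val + 1)) ∧
      ((∏ i, z i ^ (i.val + 1) : ℕ) : ℝ) = 6436343 ∧
      (((∏ p ∈ ({3, 23} : Finset ℕ), p) * ∏ p ∈ (∏ i, x i * y i * z i).primeFactors \ {3, 23},
        p ^ (∏ i, x i * y i * z i).factorization p : ℕ) : ℝ) ≤ 15042 ∧
      (15042 : ℝ) ^ ((81 : ℝ) / 50) < 6436343 := by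
  refine ⟨![2, 1, 1, 1], ![109, 3, 1, 9], ![23, 1, 1, 23], ?_, by decide, by decide, ?_, ?_, ?_⟩
  · intro i; fin_cases i <;> simp
  · simp [Fin.prod_univ_four]
  · have hM : (∏ i : Fin 4, (![2, 1, 1, 1] : Fin 4 → ℕ) i * (![109, 3, 1, 9] : Fin 4 → ℕ) i *
        (![23, 1, 1, 23] : Fin 4 → ℕ) i) = (3 ^ 3 * 23 ^ 2) * 218 := by
      simp [Fin.prod_univ_four]
    have h23 : Nat.Prime 23 := by norm_num
    rw [hM, Finset.prod_pair (by norm_num)]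
    have hu : (3 ^ 3 * 23 ^ 2 : ℕ).primeFactors ⊆ {3, 23} := by
      rw [Nat.primeFactors_mul (by norm_num) (by norm_num),
        Nat.primeFactors_prime_pow (by norm_num) Nat.prime_three,
        Nat.primeFactors_prime_pow (by norm_num) h23]
      intro r hr
      simp only [Finset.mem_union, Finset.mem_singleton] at hr
      simp only [Finset.mem_insert, Finset.mem_singleton]
      exact hr
    have hdvd := sfree_dvd (u := 3 ^ 3 * 23 ^ 2) (v := 218) (S := {3, 23}) (by norm_num) (by norm_num) hu
    have h218 : (∏ r ∈ (3 ^ 3 * 23 ^ 2 * 218).primeFactors \ {3, 23},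
        r ^ (3 ^ 3 * 23 ^ 2 * 218).factorization r) ≤ 218 :=
      Nat.le_of_dvd (by norm_num) hdvd
    have : (3 * 23 * ∏ r ∈ (3 ^ 3 * 23 ^ 2 * 218).primeFactors \ {3, 23},
        r ^ (3 ^ 3 * 23 ^ 2 * 218).factorization r) ≤ 15042 := by omega
    exact_mod_cast this
  · refine lt_of_pow_lt_pow_left₀ 50 (by norm_num) ?_
    rw [← Real.rpow_natCast, ← Real.rpow_mul (by norm_num)]
    norm_num

/-- Hence at budget `K = 2` the crux inequality with constant `C = 1` needs exponent `> 81/50`: the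
`2`-discounted cell already contains the full empirical abc frontier (Reyssat's quality `1.6299`). -/
theorem not_uniformSadicTowerFour_two_constant_one_exponent_81_50 :
    ¬ ∀ S : Finset ℕ, S.card ≤ 2 → (∀ p ∈ S, Nat.Prime p) →
      ∀ x y z : Fin 4 → ℕ, (∀ i, 0 < x i ∧ 0 < y i ∧ 0 < z i) →
      (∏ i, x i ^ (i.val + 1)) + (∏ i, y i ^ (i.val + 1)) = ∏ i, z i ^ (i.val + 1) →
      Nat.Coprime (∏ i, x i ^ (i.val + 1)) (∏ i, y i ^ (i.val + 1)) →
      ((∏ i, z i ^ (i.val + 1) : ℕ) : ℝ) < 1 * (((∏ p ∈ S, p) *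
        ∏ p ∈ (∏ i, x i * y i * z i).primeFactors \ S, p ^ (∏ i, x i * y i * z i).factorization p : ℕ) :
          ℝ) ^ ((81 : ℝ) / 50) := by
  intro h
  obtain ⟨x, y, z, hpos, heq, hcop, hc, hB, hlt⟩ := quality_point_reyssat_at_three_twentythree
  have h23 : Nat.Prime 23 := by norm_num
  have key := h {3, 23} (by rw [Finset.card_pair (by norm_num)])
    (by intro r hr
        simp only [Finset.mem_insert, Finset.mem_singleton] at hr
        rcases hr with rfl | rfl
        · exact Nat.prime_three
        · exact h23) x y z hpos heq hcop
  rw [hc, one_mul] at key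
  have hmono : (((∏ p ∈ ({3, 23} : Finset ℕ), p) * ∏ p ∈ (∏ i, x i * y i * z i).primeFactors \ {3, 23},
      p ^ (∏ i, x i * y i * z i).factorization p : ℕ) : ℝ) ^ ((81 : ℝ) / 50) ≤
      (15042 : ℝ) ^ ((81 : ℝ) / 50) :=
    Real.rpow_le_rpow (Nat.cast_nonneg _) hB (by norm_num)
  linarith

/-! ## Line `Sketch` / Targets

No stub of the picked line is refutable: `stub_core` is the crux in mixed-radical normal form (the two
transports `stub_mixed_of_tower_at` / `stub_tower_of_mixed_at` are landed, so `stub_core ↔ crux` and a kill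
of `stub_core` is again `¬ABC`); `stub_uniformInK_iff_abc`, `stub_placesToLevel`,
`stub_primeHall_of_levelOneTwo` are landed theorems; `stub_omegaCounted_two` is true and elementary (cell
`ω(abc) ≤ 2` = `{1+1=2, 1+8=9, 1+(2ⁿ−1)=2ⁿ, 1+2ᵐ=prime}` and mirror images, by `2^m + 1 = r^n, n ≥ 2 ⟹ 8+1=9`
and `q^m = 2^n − 1, m ≥ 2` impossible mod 4 / by the odd cofactor; on it `c < 2·rad(abc)`).  The composition
`UniformSadicTowerFour_of` in `Lines/Sketch.lean` is kernel-checked, so joint sufficiency has no gap.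
Payload `stuck_stubs = []`; nothing under `-- Targets` this cycle. -/

end Summit.ABC.ABC.Cruxes.UniformSadicTowerFour.Disproof
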